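import Literature.Topology.FourManifolds.PairSaddlesMC
import Literature.Topology.FourManifolds.PairLevelTransport
import Literature.Topology.FourManifolds.MilnorBoxFlowLines
import HarnessLib

/-!
# The saddle pieces of the two-field extension map: exit and entrance level transports

Topic `Literature/Topology/FourManifolds` (support file for the two-field handle-extension
endgame of `stmt-SmoothPoincare4-15190`, after `PairSaddlesMC.lean`, `PairLevelTransport.lean`).
Everything here is **proved**; the new definitions are the reference data of the pieces.

Milnor, *Lectures on the h-cobordism theorem* (1965), proof of Thm. 3.13 (PDF pp. 18–19):
near a critical point two manifolds carrying the same Morse model are compared *through the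
Milnor coordinates*, elsewhere *along the trajectories*.  For a pair of basin settings
`P : BasinPair g ξ_A ξ_B` with saddle data `Q : P.SaddleData` (`PairSaddles.lean`: boxes `DA s`,
`DB s` of common size `ε`, common saddle value `c`, model conjugations `MC s`) we set up, for
every saddle `s` and a width `δ`, two level transports (`PairLevelTransport.lean`) whose
reference map is the model conjugation `MC s`:

* `SaddleData.refExit Q s δ` — reference level `c + ε²`, reference piece the **exit annulus**
  `Uexit s δ ∩ {g = c + ε²}` (`|x⃗|² < δ` in the `3ε`-ball of `DA s`), served levels `(c, hi)`;
* `SaddleData.refEnt Q s δ` — reference level `c - ε²`, reference piece the **entrance discs**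
  `Uent s δ ∩ {g = c - ε²}` (`|y⃗|² < δ`), served levels `(g p₀, c)`;

together with the level bookkeeping they need: the critical values are `g p₀` and `c`
(`isMCriticalPt_cases`), so trajectories starting strictly between `c` and `hi` (resp. `g p₀`
and `c`) meet every level of that interval (`hits_A_of_mem_Ioo_c_hi`, …, from
`SlabFlowLevels.lean`).

## References

* J. Milnor, *Lectures on the h-cobordism theorem* (1965), Def. 3.1, Thm. 4.1, proofs of
  Thms. 3.12–3.13 (PDF pp. 12, 17–22). [MilnorHCobordism1965]
* H. B. Griffiths, *Automorphisms of a 3-dimensional handlebody*, Abh. Math. Sem. Univ. Hamburg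
  26 (1964), §§3–6. [GriffithsHB1964Handlebody]
-/

open scoped Manifold ContDiff Topology
open Set Function Filter Metric

noncomputable section

namespace Literature.Topology.FourManifolds

open Cobordism FourManifolds.Flow

universe u

variable {n : ℕ} {W : Type u} [TopologicalSpace W] [T2Space W] [SecondCountableTopology W]
  [CompactSpace W] [ChartedSpace (EuclideanHalfSpace (n + 1)) W] [IsManifold (𝓡∂ (n + 1)) ∞ W]

/-! ### Meeting levels free of critical values (one basin setting) -/

namespace BasinSetting

variable {g : W → ℝ} {ξ : Π x : W, TangentSpace (𝓡∂ (n + 1)) x} (B : BasinSetting g ξ)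

/-- **Forward**: the trajectory of `x` meets every level `ℓ ∈ [g x, hi)` if no critical value lies
in `[g x, ℓ]`. [cite: MilnorHCobordism1965, Thm. 4.1 (PDF p. 22)] -/
theorem hits_of_le (x : W) {ℓ : ℝ} (hxℓ : g x ≤ ℓ) (hℓ : ℓ < B.hi)
    (hcrit : ∀ p, IsMCriticalPt (𝓡∂ (n + 1)) g p → g p ∉ Icc (g x) ℓ) : Hits B.θ g ℓ x := by
  obtain ⟨t, -, ht⟩ := B.preSlabFlow.exists_apply_eq_of_forall_not_mem_Icc (B.lo_lt_apply x).le hxℓ hℓ hcrit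
  exact ⟨t, ht⟩

/-- **Backward**: the trajectory of `x` (with `g x ≤ hi`) meets every level `ℓ ∈ (lo, g x]` if no
critical value lies in `[ℓ, g x]`. [cite: MilnorHCobordism1965, Thm. 4.1 (PDF p. 22)] -/
theorem hits_of_ge {x : W} (hx : g x ≤ B.hi) {ℓ : ℝ} (hℓx : ℓ ≤ g x) (hℓ : B.lo < ℓ)
    (hcrit : ∀ p, IsMCriticalPt (𝓡∂ (n + 1)) g p → g p ∉ Icc ℓ (g x)) : Hits B.θ g ℓ x := by
  obtain ⟨t, -, ht⟩ := B.preSlabFlow.exists_apply_eq_of_forall_not_mem_Icc' hx hℓx hℓ hcrit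
  exact ⟨t, ht⟩

end BasinSetting

namespace BasinPair

namespace SaddleData

variable {g : W → ℝ} {ξA ξB : Π x : W, TangentSpace (𝓡∂ (n + 1)) x} {P : BasinPair g ξA ξB}
  (Q : P.SaddleData)

/-! ### Critical values and levels -/

/-- **The critical values are `g p₀` and `c`**: a critical point is the minimum or a saddle. [cite: MilnorHCobordism1965, Thm. 4.1] -/
theorem isMCriticalPt_cases {x : W} (hx : IsMCriticalPt (𝓡∂ (n + 1)) g x) : x = P.A.p₀ ∨ g x = Q.c := by
  by_cases h : x = P.A.p₀
  · exact Or.inl h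
  · exact Or.inr (Q.apply_eq_c ⟨x, hx, P.A.morseIndex_ne_zero hx h⟩)

/-- A point whose level is neither `≤ g p₀` nor `c` is not critical. [folklore] -/
theorem not_isMCriticalPt_of_apply {x : W} (h₁ : g P.A.p₀ < g x) (h₂ : g x ≠ Q.c) :
    ¬ IsMCriticalPt (𝓡∂ (n + 1)) g x := fun hx => by
  rcases Q.isMCriticalPt_cases hx with h | h
  · rw [h] at h₁; exact lt_irrefl _ h₁
  · exact h₂ h

/-- No critical value lies in an interval `[a, b]` with `g p₀ < a` and `c ∉ [a, b]`. [folklore] -/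
theorem forall_apply_not_mem_Icc {a b : ℝ} (ha : g P.A.p₀ < a) (hc : Q.c ∉ Icc a b) :
    ∀ p, IsMCriticalPt (𝓡∂ (n + 1)) g p → g p ∉ Icc a b := fun p hp hmem => by
  rcases Q.isMCriticalPt_cases hp with h | h
  · rw [h] at hmem; exact (lt_irrefl _ (ha.trans_le hmem.1))
  · rw [h] at hmem; exact hc hmem

/-- `c + ε² < L` (indeed `c + 9ε² < 1 - a' < L`). [folklore] -/
theorem c_add_sq_lt_L : Q.c + Q.ε ^ 2 < P.A.L := by
  have h1 := Q.lt_collar; have h2 := P.A.one_sub_a'_lt_L; nlinarith [Q.ε_pos]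

/-- `c + ε² < hi`. [folklore] -/
theorem c_add_sq_lt_hi : Q.c + Q.ε ^ 2 < P.A.hi := Q.c_add_sq_lt_L.trans P.A.L_lt_hi

/-- `c < hi`. [folklore] -/
theorem c_lt_hi : Q.c < P.A.hi := Q.c_lt_L.trans P.A.L_lt_hi

/-- `sph < c - ε²`. [folklore] -/
theorem sph_lt_c_sub_sq : P.A.sph < Q.c - Q.ε ^ 2 := by nlinarith [Q.sph_lt, Q.ε_pos]

/-- `g p₀ < c - ε²`. [folklore] -/
theorem apply_p₀_lt_c_sub_sq : g P.A.p₀ < Q.c - Q.ε ^ 2 := P.A.apply_p₀_lt_sph.trans Q.sph_lt_c_sub_sq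

/-- `0 < ε²`. [folklore] -/
theorem sq_pos : 0 < Q.ε ^ 2 := pow_pos Q.ε_pos 2

/-- `(c, hi) ⊆ (g p₀, hi)`. [folklore] -/
theorem Ioo_c_hi_subset : Ioo Q.c P.A.hi ⊆ Ioo (g P.A.p₀) P.A.hi := fun _ h => ⟨Q.apply_p₀_lt_c.trans h.1, h.2⟩

/-- `(g p₀, c) ⊆ (g p₀, hi)`. [folklore] -/
theorem Ioo_p₀_c_subset : Ioo (g P.A.p₀) Q.c ⊆ Ioo (g P.A.p₀) P.A.hi := fun _ h => ⟨h.1, h.2.trans Q.c_lt_hi⟩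

/-! ### Meeting the levels above and below `c` -/

/-- **A point strictly between `c` and `hi` meets, along `ξ_A`, every level of `(c, hi)`.** [cite: MilnorHCobordism1965, Thm. 4.1 (PDF p. 22)] -/
theorem hits_A_of_mem_Ioo_c_hi {x : W} (hx : g x ∈ Ioo Q.c P.A.hi) {ℓ : ℝ} (hℓ : ℓ ∈ Ioo Q.c P.A.hi) :
    Hits P.A.θ g ℓ x := by
  rcases le_total (g x) ℓ with h | h
  · exact P.A.hits_of_le x h hℓ.2 (Q.forall_apply_not_mem_Icc (Q.apply_p₀_lt_c.trans hx.1) fun hc => (lt_irrefl _ (hx.1.trans_le hc.1)))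
  · exact P.A.hits_of_ge hx.2.le h (P.A.lo_lt_apply_p₀.trans (Q.apply_p₀_lt_c.trans hℓ.1))
      (Q.forall_apply_not_mem_Icc (Q.apply_p₀_lt_c.trans hℓ.1) fun hc => (lt_irrefl _ (hℓ.1.trans_le hc.1)))

/-- **A point strictly between `c` and `hi` meets, along `ξ_B`, every level of `(c, hi)`.** [cite: MilnorHCobordism1965, Thm. 4.1 (PDF p. 22)] -/
theorem hits_B_of_mem_Ioo_c_hi {x : W} (hx : g x ∈ Ioo Q.c P.A.hi) {ℓ : ℝ} (hℓ : ℓ ∈ Ioo Q.c P.A.hi) :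
    Hits P.B.θ g ℓ x :=
  Q.swap.hits_A_of_mem_Ioo_c_hi (by rw [swap_A, P.hi_eq]; exact hx) (by rw [swap_A, P.hi_eq]; exact hℓ)

/-- **A point strictly between `g p₀` and `c` meets, along `ξ_A`, every level of `(g p₀, c)`.** [cite: MilnorHCobordism1965, Thm. 4.1 (PDF p. 22)] -/
theorem hits_A_of_mem_Ioo_p₀_c {x : W} (hx : g x ∈ Ioo (g P.A.p₀) Q.c) {ℓ : ℝ} (hℓ : ℓ ∈ Ioo (g P.A.p₀) Q.c) :
    Hits P.A.θ g ℓ x := by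
  rcases le_total (g x) ℓ with h | h
  · exact P.A.hits_of_le x h (hℓ.2.trans Q.c_lt_hi)
      (Q.forall_apply_not_mem_Icc hx.1 fun hc => (lt_irrefl _ (hℓ.2.trans_le' hc.2)))
  · exact P.A.hits_of_ge (hx.2.trans Q.c_lt_hi).le h (P.A.lo_lt_apply_p₀.trans hℓ.1)
      (Q.forall_apply_not_mem_Icc hℓ.1 fun hc => (lt_irrefl _ (hx.2.trans_le' hc.2)))

/-- **A point strictly between `g p₀` and `c` meets, along `ξ_B`, every level of `(g p₀, c)`.** [cite: MilnorHCobordism1965, Thm. 4.1 (PDF p. 22)] -/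
theorem hits_B_of_mem_Ioo_p₀_c {x : W} (hx : g x ∈ Ioo (g P.A.p₀) Q.c) {ℓ : ℝ} (hℓ : ℓ ∈ Ioo (g P.A.p₀) Q.c) :
    Hits P.B.θ g ℓ x :=
  Q.swap.hits_A_of_mem_Ioo_p₀_c (by rw [swap_A, P.apply_p₀_eq]; exact hx) (by rw [swap_A, P.apply_p₀_eq]; exact hℓ)

/-! ### The exit annulus and the entrance discs of a saddle -/

/-- **The exit set** of the saddle `s` of width `δ`: points of the `3ε`-ball of `DA s` with
`|x⃗|² < δ` (its slice `{g = c + ε²}` is the exit annulus about the unstable sphere). [cite: MilnorHCobordism1965, proof of Thm. 3.13 (PDF pp. 18–19)] -/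
def Uexit (s : SaddlePt n g) (δ : ℝ) : Set W :=
  {z | z ∈ (Q.DA s).chartBall (3 * Q.ε) ∧ sqSumLT (Q.DA s).k ((Q.DA s).coord z) < δ}

/-- **The entrance set** of the saddle `s` of width `δ`: points of the `3ε`-ball of `DA s` with
`|y⃗|² < δ` (its slice `{g = c - ε²}` is the pair of entrance discs about the stable sphere). [cite: MilnorHCobordism1965, proof of Thm. 3.13 (PDF pp. 18–19)] -/
def Uent (s : SaddlePt n g) (δ : ℝ) : Set W :=
  {z | z ∈ (Q.DA s).chartBall (3 * Q.ε) ∧ sqSumGE (Q.DA s).k ((Q.DA s).coord z) < δ}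

variable {Q}

/-- Membership in the exit set. [folklore] -/
theorem mem_Uexit_iff {s : SaddlePt n g} {δ : ℝ} {z : W} :
    z ∈ Q.Uexit s δ ↔ z ∈ (Q.DA s).chartBall (3 * Q.ε) ∧ sqSumLT (Q.DA s).k ((Q.DA s).coord z) < δ := Iff.rfl

/-- Membership in the entrance set. [folklore] -/
theorem mem_Uent_iff {s : SaddlePt n g} {δ : ℝ} {z : W} :
    z ∈ Q.Uent s δ ↔ z ∈ (Q.DA s).chartBall (3 * Q.ε) ∧ sqSumGE (Q.DA s).k ((Q.DA s).coord z) < δ := Iff.rfl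

/-- The exit sets grow with the width. [folklore] -/
theorem Uexit_mono {s : SaddlePt n g} {δ δ' : ℝ} (h : δ ≤ δ') : Q.Uexit s δ ⊆ Q.Uexit s δ' :=
  fun _ hz => ⟨hz.1, hz.2.trans_le h⟩

/-- The entrance sets grow with the width. [folklore] -/
theorem Uent_mono {s : SaddlePt n g} {δ δ' : ℝ} (h : δ ≤ δ') : Q.Uent s δ ⊆ Q.Uent s δ' :=
  fun _ hz => ⟨hz.1, hz.2.trans_le h⟩

variable (Q)

/-- The exit set is open. [folklore] -/
theorem isOpen_Uexit (s : SaddlePt n g) (δ : ℝ) : IsOpen (Q.Uexit s δ) := by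
  have h1 : IsOpen ((Q.DA s).chart.source ∩ (Q.DA s).coord ⁻¹' (sqSumLT (Q.DA s).k ⁻¹' Iio δ)) :=
    (Q.DA s).continuousOn_coord.isOpen_inter_preimage (Q.DA s).chart.open_source
      (isOpen_Iio.preimage (continuous_sqSumLT _))
  have h2 : Q.Uexit s δ = (Q.DA s).chartBall (3 * Q.ε) ∩
      ((Q.DA s).chart.source ∩ (Q.DA s).coord ⁻¹' (sqSumLT (Q.DA s).k ⁻¹' Iio δ)) := by
    ext z; simp only [Uexit, mem_setOf_eq, mem_inter_iff, mem_preimage, mem_Iio, MilnorBox.mem_chartBall_iff]; tauto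
  rw [h2]; exact (Q.DA s).isOpen_chartBall.inter h1

/-- The entrance set is open. [folklore] -/
theorem isOpen_Uent (s : SaddlePt n g) (δ : ℝ) : IsOpen (Q.Uent s δ) := by
  have h1 : IsOpen ((Q.DA s).chart.source ∩ (Q.DA s).coord ⁻¹' (sqSumGE (Q.DA s).k ⁻¹' Iio δ)) :=
    (Q.DA s).continuousOn_coord.isOpen_inter_preimage (Q.DA s).chart.open_source
      (isOpen_Iio.preimage (continuous_sqSumGE _))
  have h2 : Q.Uent s δ = (Q.DA s).chartBall (3 * Q.ε) ∩
      ((Q.DA s).chart.source ∩ (Q.DA s).coord ⁻¹' (sqSumGE (Q.DA s).k ⁻¹' Iio δ)) := by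
    ext z; simp only [Uent, mem_setOf_eq, mem_inter_iff, mem_preimage, mem_Iio, MilnorBox.mem_chartBall_iff]; tauto
  rw [h2]; exact (Q.DA s).isOpen_chartBall.inter h1

/-- A level other than `c` above `g p₀`, as carried by `MC`: the image is non-critical. [folklore] -/
theorem not_isMCriticalPt_MC {s : SaddlePt n g} {z : W} (hz : z ∈ (Q.DA s).chartBall (3 * Q.ε))
    (h₁ : g P.A.p₀ < g z) (h₂ : g z ≠ Q.c) : ¬ IsMCriticalPt (𝓡∂ (n + 1)) g (Q.MC s z) :=
  Q.not_isMCriticalPt_of_apply (by rw [Q.apply_MC hz.1 hz.2.le]; exact h₁) (by rw [Q.apply_MC hz.1 hz.2.le]; exact h₂)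

/-! ### The exit level transport -/

/-- **The reference data of the exit piece of the saddle `s`**: level `c + ε²`, the exit annulus
of width `δ`, served levels `(c, hi)`, reference map `MC s`. [cite: MilnorHCobordism1965, proof of Thm. 3.13 (PDF pp. 18–19)] [cite: GriffithsHB1964Handlebody, §§3–6] -/
def refExit (s : SaddlePt n g) (δ : ℝ) : P.RefData where
  ℓ₀ := Q.c + Q.ε ^ 2
  ℓ₀_mem := ⟨Q.apply_p₀_lt_c.trans (lt_add_of_pos_right _ Q.sq_pos), Q.c_add_sq_lt_hi⟩
  U := Q.Uexit s δ
  isOpen_U := Q.isOpen_Uexit s δ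
  I₀ := Ioo Q.c P.A.hi
  isOpen_I₀ := isOpen_Ioo
  I₀_subset := Q.Ioo_c_hi_subset
  Φ := Q.MC s
  apply_Φ w hw hwℓ := by rw [Q.apply_MC hw.1.1 hw.1.2.le, hwℓ]
  hits_Φ w hw hwℓ ℓ hℓ := Q.hits_B_of_mem_Ioo_c_hi
    (by rw [Q.apply_MC hw.1.1 hw.1.2.le, hwℓ]; exact ⟨lt_add_of_pos_right _ Q.sq_pos, Q.c_add_sq_lt_hi⟩) hℓ
  reg_Φ w hw hwℓ := Q.not_isMCriticalPt_MC hw.1 (by rw [hwℓ]; exact Q.apply_p₀_lt_c.trans (lt_add_of_pos_right _ Q.sq_pos))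
    (by rw [hwℓ]; exact ne_of_gt (lt_add_of_pos_right _ Q.sq_pos))
  contMDiffAt_Φ w hw _ := Q.contMDiffAt_MC hw.1.1 hw.1.2

/-- The reference level of the exit piece. [folklore] -/
@[simp] theorem refExit_ℓ₀ (s : SaddlePt n g) (δ : ℝ) : (Q.refExit s δ).ℓ₀ = Q.c + Q.ε ^ 2 := rfl

/-- The reference set of the exit piece. [folklore] -/
@[simp] theorem refExit_U (s : SaddlePt n g) (δ : ℝ) : (Q.refExit s δ).U = Q.Uexit s δ := rfl

/-- The served levels of the exit piece. [folklore] -/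
@[simp] theorem refExit_I₀ (s : SaddlePt n g) (δ : ℝ) : (Q.refExit s δ).I₀ = Ioo Q.c P.A.hi := rfl

/-- The reference map of the exit piece. [folklore] -/
@[simp] theorem refExit_Φ (s : SaddlePt n g) (δ : ℝ) : (Q.refExit s δ).Φ = Q.MC s := rfl

/-- **Membership in the domain of the exit piece.** [folklore] -/
theorem mem_dom_refExit_iff {s : SaddlePt n g} {δ : ℝ} {x : W} : x ∈ (Q.refExit s δ).dom ↔
    g x ∈ Ioo Q.c P.A.hi ∧ ¬ IsMCriticalPt (𝓡∂ (n + 1)) g x ∧ Hits P.A.θ g (Q.c + Q.ε ^ 2) x ∧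
      levelProj P.A.θ g (Q.c + Q.ε ^ 2) x ∈ Q.Uexit s δ := Iff.rfl

/-- A point between `c` and `hi` whose `ξ_A`-level point at `c + ε²` lies in the exit set is in
the domain of the exit piece (meeting and regularity are automatic). [folklore] -/
theorem mem_dom_refExit {s : SaddlePt n g} {δ : ℝ} {x : W} (hx : g x ∈ Ioo Q.c P.A.hi)
    (hU : levelProj P.A.θ g (Q.c + Q.ε ^ 2) x ∈ Q.Uexit s δ) : x ∈ (Q.refExit s δ).dom :=
  ⟨hx, Q.not_isMCriticalPt_of_apply (Q.apply_p₀_lt_c.trans hx.1) (ne_of_gt hx.1),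
    Q.hits_A_of_mem_Ioo_c_hi hx ⟨lt_add_of_pos_right _ Q.sq_pos, Q.c_add_sq_lt_hi⟩, hU⟩

/-- The domains of the exit pieces grow with the width. [folklore] -/
theorem dom_refExit_mono (s : SaddlePt n g) {δ δ' : ℝ} (h : δ ≤ δ') : (Q.refExit s δ).dom ⊆ (Q.refExit s δ').dom :=
  fun _ hx => ⟨hx.1, hx.2.1, hx.2.2.1, Uexit_mono h hx.2.2.2⟩

/-- On the smaller domain the exit transports of two widths agree (same formula). [folklore] -/
theorem LT_refExit_eq (s : SaddlePt n g) (δ δ' : ℝ) (x : W) : (Q.refExit s δ).LT x = (Q.refExit s δ').LT x := rfl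

/-! ### The entrance level transport -/

/-- **The reference data of the entrance piece of the saddle `s`**: level `c - ε²`, the entrance
discs of width `δ`, served levels `(g p₀, c)`, reference map `MC s`. [cite: MilnorHCobordism1965, proof of Thm. 3.13 (PDF pp. 18–19)] [cite: GriffithsHB1964Handlebody, §§3–6] -/
def refEnt (s : SaddlePt n g) (δ : ℝ) : P.RefData where
  ℓ₀ := Q.c - Q.ε ^ 2
  ℓ₀_mem := ⟨Q.apply_p₀_lt_c_sub_sq, (sub_lt_self _ Q.sq_pos).trans Q.c_lt_hi⟩
  U := Q.Uent s δ
  isOpen_U := Q.isOpen_Uent s δ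
  I₀ := Ioo (g P.A.p₀) Q.c
  isOpen_I₀ := isOpen_Ioo
  I₀_subset := Q.Ioo_p₀_c_subset
  Φ := Q.MC s
  apply_Φ w hw hwℓ := by rw [Q.apply_MC hw.1.1 hw.1.2.le, hwℓ]
  hits_Φ w hw hwℓ ℓ hℓ := Q.hits_B_of_mem_Ioo_p₀_c
    (by rw [Q.apply_MC hw.1.1 hw.1.2.le, hwℓ]; exact ⟨Q.apply_p₀_lt_c_sub_sq, sub_lt_self _ Q.sq_pos⟩) hℓ
  reg_Φ w hw hwℓ := Q.not_isMCriticalPt_MC hw.1 (by rw [hwℓ]; exact Q.apply_p₀_lt_c_sub_sq)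
    (by rw [hwℓ]; exact ne_of_lt (sub_lt_self _ Q.sq_pos))
  contMDiffAt_Φ w hw _ := Q.contMDiffAt_MC hw.1.1 hw.1.2

/-- The reference level of the entrance piece. [folklore] -/
@[simp] theorem refEnt_ℓ₀ (s : SaddlePt n g) (δ : ℝ) : (Q.refEnt s δ).ℓ₀ = Q.c - Q.ε ^ 2 := rfl

/-- The reference set of the entrance piece. [folklore] -/
@[simp] theorem refEnt_U (s : SaddlePt n g) (δ : ℝ) : (Q.refEnt s δ).U = Q.Uent s δ := rfl

/-- The served levels of the entrance piece. [folklore] -/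
@[simp] theorem refEnt_I₀ (s : SaddlePt n g) (δ : ℝ) : (Q.refEnt s δ).I₀ = Ioo (g P.A.p₀) Q.c := rfl

/-- The reference map of the entrance piece. [folklore] -/
@[simp] theorem refEnt_Φ (s : SaddlePt n g) (δ : ℝ) : (Q.refEnt s δ).Φ = Q.MC s := rfl

/-- **Membership in the domain of the entrance piece.** [folklore] -/
theorem mem_dom_refEnt_iff {s : SaddlePt n g} {δ : ℝ} {x : W} : x ∈ (Q.refEnt s δ).dom ↔
    g x ∈ Ioo (g P.A.p₀) Q.c ∧ ¬ IsMCriticalPt (𝓡∂ (n + 1)) g x ∧ Hits P.A.θ g (Q.c - Q.ε ^ 2) x ∧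
      levelProj P.A.θ g (Q.c - Q.ε ^ 2) x ∈ Q.Uent s δ := Iff.rfl

/-- A point between `g p₀` and `c` whose `ξ_A`-level point at `c - ε²` lies in the entrance set
is in the domain of the entrance piece. [folklore] -/
theorem mem_dom_refEnt {s : SaddlePt n g} {δ : ℝ} {x : W} (hx : g x ∈ Ioo (g P.A.p₀) Q.c)
    (hU : levelProj P.A.θ g (Q.c - Q.ε ^ 2) x ∈ Q.Uent s δ) : x ∈ (Q.refEnt s δ).dom :=
  ⟨hx, Q.not_isMCriticalPt_of_apply hx.1 (ne_of_lt hx.2),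
    Q.hits_A_of_mem_Ioo_p₀_c hx ⟨Q.apply_p₀_lt_c_sub_sq, sub_lt_self _ Q.sq_pos⟩, hU⟩

/-- The domains of the entrance pieces grow with the width. [folklore] -/
theorem dom_refEnt_mono (s : SaddlePt n g) {δ δ' : ℝ} (h : δ ≤ δ') : (Q.refEnt s δ).dom ⊆ (Q.refEnt s δ').dom :=
  fun _ hx => ⟨hx.1, hx.2.1, hx.2.2.1, Uent_mono h hx.2.2.2⟩

/-! ### Swapping -/

/-- **The exit set is carried by `MC` into the exit set of the corresponding `B`-box** (which is
the exit set of the swapped data at `σ s`): coordinates are preserved. [folklore] -/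
theorem MC_mem_Uexit_swap {s : SaddlePt n g} {δ : ℝ} {z : W} (hz : z ∈ Q.Uexit s δ) :
    Q.MC s z ∈ Q.swap.Uexit (Q.σ s) δ := by
  refine ⟨?_, ?_⟩
  · exact Q.MC_mem_chartBall le_rfl hz.1
  · show sqSumLT (Q.DB (Q.σ s)).k ((Q.DB (Q.σ s)).coord (Q.MC s z)) < δ
    rw [Q.sqSumLT_coord_MC hz.1.2.le]; exact hz.2

/-- The entrance set is carried by `MC` into the entrance set of the swapped data at `σ s`. [folklore] -/
theorem MC_mem_Uent_swap {s : SaddlePt n g} {δ : ℝ} {z : W} (hz : z ∈ Q.Uent s δ) :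
    Q.MC s z ∈ Q.swap.Uent (Q.σ s) δ := by
  refine ⟨?_, ?_⟩
  · exact Q.MC_mem_chartBall le_rfl hz.1
  · show sqSumGE (Q.DB (Q.σ s)).k ((Q.DB (Q.σ s)).coord (Q.MC s z)) < δ
    rw [Q.sqSumGE_coord_MC hz.1.2.le]; exact hz.2

/-- **The exit transport of the swapped data at `σ s` inverts the exit transport at `s`** on the
domain, and carries it into its own domain. [cite: GriffithsHB1964Handlebody, §§3–6] -/
theorem LT_refExit_swap_LT {s : SaddlePt n g} {δ : ℝ} {x : W} (hx : x ∈ (Q.refExit s δ).dom) :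
    (Q.refExit s δ).LT x ∈ (Q.swap.refExit (Q.σ s) δ).dom ∧
      (Q.swap.refExit (Q.σ s) δ).LT ((Q.refExit s δ).LT x) = x := by
  refine RefData.LT_LT_of_inverse (Q.swap.refExit (Q.σ s) δ) rfl (fun w hw _ => Q.MC_mem_Uexit_swap hw)
    (fun w hw _ => ?_) hx ?_
  · show Q.swap.MC (Q.σ s) (Q.MC s w) = w
    rw [Q.swap_MC]; exact Q.MCi_MC hw.1.1 hw.1.2.le
  · show g x ∈ Ioo Q.c P.swap.A.hi
    rw [swap_A, P.hi_eq]; exact hx.1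

/-- **The entrance transport of the swapped data at `σ s` inverts the entrance transport at `s`.** [cite: GriffithsHB1964Handlebody, §§3–6] -/
theorem LT_refEnt_swap_LT {s : SaddlePt n g} {δ : ℝ} {x : W} (hx : x ∈ (Q.refEnt s δ).dom) :
    (Q.refEnt s δ).LT x ∈ (Q.swap.refEnt (Q.σ s) δ).dom ∧
      (Q.swap.refEnt (Q.σ s) δ).LT ((Q.refEnt s δ).LT x) = x := by
  refine RefData.LT_LT_of_inverse (Q.swap.refEnt (Q.σ s) δ) rfl (fun w hw _ => Q.MC_mem_Uent_swap hw)
    (fun w hw _ => ?_) hx ?_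
  · show Q.swap.MC (Q.σ s) (Q.MC s w) = w
    rw [Q.swap_MC]; exact Q.MCi_MC hw.1.1 hw.1.2.le
  · show g x ∈ Ioo (g P.swap.A.p₀) Q.c
    rw [swap_A, P.apply_p₀_eq]; exact hx.1

end SaddleData

end BasinPair

end Literature.Topology.FourManifolds
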